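import Mathlib.Tactic.Linarith
import Summits.CriticalPhenomena.PercolationContinuityZ3.Theorems.PercNearOneGluingNoHeavyLowerTailSahiCTCHarrisUpGround
import Summits.CriticalPhenomena.PercolationContinuityZ3.Theorems.PercNearOneGluingNoHeavyLowerTailSahiCTCVertexAtoms
import HarnessLib

/-!
# `NoHeavyLowerTail` (crux stmt-CriticalPhenomena-4575), P3 lane: the COMMON-EDGE HARRIS BOUND
# `Π·Y − X·Z ≥ s_u s_v (1 + s_u + s_v)·Π_{V∖uv}` coefficientwise for all-live up-sets sharing the 2-set `{u,v}` (every finite type)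

Support file (seat `prim-l12-p3`, gen 24; `--supports stmt-CriticalPhenomena-4575`).  Memo `run/shared/lean/prim/prim-l12/FROM-prim-l12-p3-g24-VALUE-
LEVEL-TH2K.md` §2c.  For up-sets `𝒳, 𝒵 ⊆ 2^α` all of whose members have size `≥ 2` ("all-live") with a common member `{u,v}`, the Harris form
`H = Π·GF(𝒳∩𝒵) − GF(𝒳)·GF(𝒵)` dominates, coefficient by coefficient, the Harris form `s_us_v(1+s_u+s_v)·Π_{V∖uv}` of the pair `(↑{u,v}, ↑{u,v})`
(value level: `Cov(𝒳,𝒵) ≥ μ(uv)·(1 − p_up_v)`, the conditioning bound of memo §2.3).  With the scalar certificate of memo §2b this gives CTC at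
co-level 2 for all-live pairs with a single common edge (not in this file).
Proof (memo §2c): split every generating function at `u` and at `v` (`…SahiCTCVertexAtoms.gf_powerset_filter_split`) into the four SECTIONS over
`G = univ ∖ {u,v}` — `X0 = {S ⊆ G : S ∈ 𝒳} ⊆ Xu = {S ⊆ G : S ∪ u ∈ 𝒳}, Xv`, and `{S ⊆ G : S ∪ uv ∈ 𝒳} = 2^G` — and check the eight slices:
`[1], [s_u], [s_v], [s_u²], [s_v²]` are (sums of) relative up-set Harris blocks (`…SahiCTCHarrisUpGround.coeff_harris_upIn_sub_nonneg`) and products of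
generating functions; `[s_u²s_v] − Π_G = Π_G·GF(nonempty sets in neither Xu nor Zu)`; `[s_us_v] − Π_G` = two cross Harris blocks `+ Π_G·D` with
`D = GF(N0∖{∅}) + GF(Yu) + GF(Yv) − GF(Xu∩Zv) − GF(Xv∩Zu) ∈ ℕ[s]` by a set-by-set inclusion (`coeff_crossDefect_nonneg`).
* `coeff_gf_ind`, `gf_sections` (the two-point split), `PiP_sections`;
* `coeff_crossDefect_nonneg`;  **`coeff_harris_sub_edge_nonneg`** (the bound);
* `coeff_M2_singleEdge_nonneg_of_cert` : the all-live co-level-2 master polynomial of a pair with a single common edge is `≥ 0` coefficientwise as soon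
  as the scalar certificate `Π_G·F ∈ ℕ[s]` of memo §2b holds (taken as a hypothesis; identity `M₂ = e₂(Π+Θ₁)(H − H(↑uv,↑uv)) + s_us_v·Π_G·F`).
Nothing is asserted about the crux.
-/

namespace Summit.CriticalPhenomena.PercolationContinuityZ3.Theorems.SahiCTCForms

open Finset MvPolynomial SahiCTCGenFun

variable {α : Type*} [DecidableEq α] [Fintype α]

/-! ### Coefficients of a generating function at `1_B` -/

omit [Fintype α] in
/-- `coeff_{1_B} GF(F) = [B ∈ F]`. [this work] -/
theorem coeff_gf_ind (F : Finset (Finset α)) (B : Finset α) :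
    (gf F).coeff (ind B) = if B ∈ F then 1 else 0 := by
  rw [coeff_gf]
  have : F.filter (fun S => ind S = ind B) = F.filter (fun S => S = B) :=
    filter_congr fun S _ => ⟨fun h => ind_injective h, fun h => by rw [h]⟩
  rw [this]
  split_ifs with hB
  · rw [filter_eq' F B, if_pos hB, card_singleton]; rfl
  · rw [filter_eq' F B, if_neg hB, card_empty]; rfl

omit [Fintype α] in
/-- A profile that is not of the form `1_B` is not a coefficient of any generating function. [this work] -/
theorem coeff_gf_eq_zero_of_ne_ind (F : Finset (Finset α)) {n : α →₀ ℕ} (hn : ∀ B : Finset α, ind B ≠ n) :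
    (gf F).coeff n = 0 := by
  rw [coeff_gf]
  have : F.filter (fun S => ind S = n) = ∅ := filter_eq_empty_iff.2 fun S _ h => hn S h
  rw [this, card_empty]; rfl

omit [Fintype α] in
/-- `GF(A ∪ B) + GF(A ∩ B) = GF(A) + GF(B)`. [this work] -/
theorem gf_union_add_gf_inter (A B : Finset (Finset α)) : gf (A ∪ B) + gf (A ∩ B) = gf A + gf B := by
  unfold gf; rw [sum_union_inter]

omit [Fintype α] in
/-- `GF(A ∖ B) = GF(A) − GF(B)` for `B ⊆ A`. [this work] -/
theorem gf_sdiff_eq {A B : Finset (Finset α)} (h : B ⊆ A) : gf (A \ B) = gf A - gf B := by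
  rw [eq_sub_iff_add_eq, ← gf_union sdiff_disjoint, sdiff_union_of_subset h]

omit [Fintype α] in
/-- `GF(F.erase ∅) = GF(F) − 1` when `∅ ∈ F`. [this work] -/
theorem gf_erase_empty {F : Finset (Finset α)} (h : ∅ ∈ F) : gf (F.erase ∅) = gf F - 1 := by
  rw [eq_sub_iff_add_eq]
  unfold gf
  rw [show (1 : MvPolynomial α ℤ) = monomial (ind (∅ : Finset α)) 1 from by unfold ind; rw [sum_empty]; rfl,
    sum_erase_add _ _ h]

/-! ### Sections of a family at two points -/

/-- Any family is the filter of the full power set by membership. [this work] -/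
theorem eq_univ_powerset_filter_mem (𝒳 : Finset (Finset α)) :
    𝒳 = (univ : Finset α).powerset.filter fun S => S ∈ 𝒳 := by
  ext S; simp only [mem_filter, mem_powerset, subset_univ, true_and]

/-- **Two-point split of a generating function**: with `G = (univ.erase u).erase v`,
`GF(𝒳) = GF{S ⊆ G : S ∈ 𝒳} + s_v·GF{S ⊆ G : S∪v ∈ 𝒳} + s_u·(GF{S ⊆ G : S∪u ∈ 𝒳} + s_v·GF{S ⊆ G : S∪u∪v ∈ 𝒳})`. [this work] -/
theorem gf_sections (𝒳 : Finset (Finset α)) {u v : α} (huv : u ≠ v) :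
    gf 𝒳 = gf (((univ.erase u).erase v).powerset.filter fun S => S ∈ 𝒳)
      + X v * gf (((univ.erase u).erase v).powerset.filter fun S => insert v S ∈ 𝒳)
      + X u * (gf (((univ.erase u).erase v).powerset.filter fun S => insert u S ∈ 𝒳)
        + X v * gf (((univ.erase u).erase v).powerset.filter fun S => insert u (insert v S) ∈ 𝒳)) := by
  have hv : v ∈ (univ : Finset α).erase u := mem_erase.2 ⟨huv.symm, mem_univ v⟩
  conv_lhs => rw [eq_univ_powerset_filter_mem 𝒳, gf_powerset_filter_split (mem_univ u) (fun S => S ∈ 𝒳)]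
  rw [gf_powerset_filter_split hv (fun S => S ∈ 𝒳), gf_powerset_filter_split hv (fun S => insert u S ∈ 𝒳)]

/-- Two-point split of `Π`: `Π = Π_G·(1 + s_u)(1 + s_v)`. [this work] -/
theorem PiP_sections {u v : α} (huv : u ≠ v) :
    (PiP : MvPolynomial α ℤ) = gf ((univ.erase u).erase v).powerset * (1 + X u) * (1 + X v) := by
  have hv : v ∈ (univ : Finset α).erase u := mem_erase.2 ⟨huv.symm, mem_univ v⟩
  unfold PiP
  rw [gf_powerset_split (mem_univ u), gf_powerset_split hv]; ring

/-! ### The cross defect is coefficientwise nonnegative -/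

/-- **Set-by-set lemma behind the `[s_us_v]` slice.**  For up-sets `𝒳, 𝒵` with all members of size `≥ 2`, `u ≠ v`, `G = univ ∖ {u,v}` and the sections
`X0 = {S ⊆ G : S ∈ 𝒳}`, `Xu = {S ⊆ G : S∪u ∈ 𝒳}`, `Xv`, (same for `𝒵`), every coefficient of
`GF((2^G ∖ (X0 ∪ Z0)) ∖ {∅}) + GF(Xu ∩ Zu) + GF(Xv ∩ Zv) − GF(Xu ∩ Zv) − GF(Xv ∩ Zu)` is `≥ 0`. [this work] -/
theorem coeff_crossDefect_nonneg {𝒳 𝒵 : Finset (Finset α)} (h𝒳 : IsUpperSet (𝒳 : Set (Finset α)))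
    (h𝒵 : IsUpperSet (𝒵 : Set (Finset α))) (hl𝒳 : ∀ S ∈ 𝒳, 2 ≤ #S) {u v : α} (G : Finset α) (n : α →₀ ℕ) :
    0 ≤ (gf (((G.powerset \ ((G.powerset.filter fun S => S ∈ 𝒳) ∪ (G.powerset.filter fun S => S ∈ 𝒵))).erase ∅))
        + gf ((G.powerset.filter fun S => insert u S ∈ 𝒳) ∩ (G.powerset.filter fun S => insert u S ∈ 𝒵))
        + gf ((G.powerset.filter fun S => insert v S ∈ 𝒳) ∩ (G.powerset.filter fun S => insert v S ∈ 𝒵))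
        - gf ((G.powerset.filter fun S => insert u S ∈ 𝒳) ∩ (G.powerset.filter fun S => insert v S ∈ 𝒵))
        - gf ((G.powerset.filter fun S => insert v S ∈ 𝒳) ∩ (G.powerset.filter fun S => insert u S ∈ 𝒵))).coeff n := by
  by_cases hn : ∃ B : Finset α, ind B = n
  · obtain ⟨B, rfl⟩ := hn
    simp only [coeff_add, coeff_sub, coeff_gf_ind, mem_erase, mem_sdiff, mem_union, mem_inter, mem_filter, mem_powerset]
    by_cases hBG : B ⊆ G
    · rcases eq_or_ne B ∅ with rfl | hB
      · -- B = ∅: every section membership of a singleton fails (all-live 𝒳)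
        have hu : ({u} : Finset α) ∉ 𝒳 := fun h => by have h2 := hl𝒳 _ h; rw [card_singleton] at h2; omega
        have hv : ({v} : Finset α) ∉ 𝒳 := fun h => by have h2 := hl𝒳 _ h; rw [card_singleton] at h2; omega
        simp [hu, hv]
      have hux : B ∈ 𝒳 → insert u B ∈ 𝒳 := fun h => h𝒳 (subset_insert u B) h
      have hvx : B ∈ 𝒳 → insert v B ∈ 𝒳 := fun h => h𝒳 (subset_insert v B) h
      have huz : B ∈ 𝒵 → insert u B ∈ 𝒵 := fun h => h𝒵 (subset_insert u B) h
      have hvz : B ∈ 𝒵 → insert v B ∈ 𝒵 := fun h => h𝒵 (subset_insert v B) h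
      by_cases hxu : insert u B ∈ 𝒳 <;> by_cases hxv : insert v B ∈ 𝒳 <;> by_cases hzu : insert u B ∈ 𝒵 <;>
        by_cases hzv : insert v B ∈ 𝒵 <;> by_cases hx0 : B ∈ 𝒳 <;> by_cases hz0 : B ∈ 𝒵 <;>
        first
          | exact absurd (hux hx0) hxu
          | exact absurd (hvx hx0) hxv
          | exact absurd (huz hz0) hzu
          | exact absurd (hvz hz0) hzv
          | simp [hBG, hxu, hxv, hzu, hzv, hx0, hz0, hB]
    · simp [hBG]
  · have hn' : ∀ B : Finset α, ind B ≠ n := fun B h => hn ⟨B, h⟩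
    simp only [coeff_add, coeff_sub, coeff_gf_eq_zero_of_ne_ind _ hn']
    norm_num

/-! ### The common-edge Harris bound -/

omit [DecidableEq α] [Fintype α] in
/-- `s_w = GF({{w}})`. [this work] -/
theorem X_eq_gf_singleton (w : α) : (X w : MvPolynomial α ℤ) = gf ({{w}} : Finset (Finset α)) := by
  unfold gf ind; rw [sum_singleton, sum_singleton]; rfl

omit [Fintype α] in
/-- The coefficients of `s_w` are nonnegative. [this work] -/
theorem coeff_X_nonneg' (w : α) (m : α →₀ ℕ) : 0 ≤ (X w : MvPolynomial α ℤ).coeff m := by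
  rw [X_eq_gf_singleton]; exact coeff_gf_nonneg _ m

omit [Fintype α] in
/-- Sections at a member `{u,v}` of an up-set are the whole cube `2^G`. [this work] -/
theorem sections_pair_eq {𝒳 : Finset (Finset α)} (h𝒳 : IsUpperSet (𝒳 : Set (Finset α))) {u v : α} (he : {u, v} ∈ 𝒳)
    (G : Finset α) : (G.powerset.filter fun S => insert u (insert v S) ∈ 𝒳) = G.powerset := by
  refine filter_true_of_mem fun S _ => h𝒳 ?_ he
  intro x hx
  rcases mem_insert.1 hx with rfl | hx
  · exact mem_insert_self _ _
  · rw [mem_singleton] at hx; subst hx; exact mem_insert_of_mem (mem_insert_self _ _)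

omit [Fintype α] in
/-- Sections commute with intersection. [this work] -/
theorem filter_mem_inter_eq (𝒳 𝒵 : Finset (Finset α)) (G : Finset α) (f : Finset α → Finset α) :
    (G.powerset.filter fun S => f S ∈ 𝒳 ∩ 𝒵) = (G.powerset.filter fun S => f S ∈ 𝒳) ∩ (G.powerset.filter fun S => f S ∈ 𝒵) := by
  ext S; simp only [mem_filter, mem_inter]; tauto

/-- **The common-edge Harris bound** (memo g24 §2c): for up-sets `𝒳, 𝒵` all of whose members have size `≥ 2` and a common member `{u,v}`
(`u ≠ v`), every coefficient of `Π·GF(𝒳∩𝒵) − GF(𝒳)·GF(𝒵) − s_us_v(1 + s_u + s_v)·Π_{univ∖{u,v}}` is nonnegative; i.e. the Harris form of the pair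
dominates coefficientwise the Harris form of `(↑{u,v}, ↑{u,v})` (value level: `Cov(𝒳,𝒵) ≥ μ(uv)(1 − p_up_v)`). [this work] -/
theorem coeff_harris_sub_edge_nonneg {𝒳 𝒵 : Finset (Finset α)} (h𝒳 : IsUpperSet (𝒳 : Set (Finset α)))
    (h𝒵 : IsUpperSet (𝒵 : Set (Finset α))) (hl𝒳 : ∀ S ∈ 𝒳, 2 ≤ #S) (hl𝒵 : ∀ S ∈ 𝒵, 2 ≤ #S) {u v : α} (huv : u ≠ v)
    (he𝒳 : {u, v} ∈ 𝒳) (he𝒵 : {u, v} ∈ 𝒵) (n : α →₀ ℕ) :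
    0 ≤ (PiP * gf (𝒳 ∩ 𝒵) - gf 𝒳 * gf 𝒵
      - X u * X v * (1 + X u + X v) * gf ((univ.erase u).erase v).powerset).coeff n := by
  -- the ground set and the sections
  obtain ⟨G, hG⟩ : ∃ G : Finset α, G = (univ.erase u).erase v := ⟨_, rfl⟩
  obtain ⟨X0, hX0⟩ : ∃ F : Finset (Finset α), F = G.powerset.filter fun S => S ∈ 𝒳 := ⟨_, rfl⟩
  obtain ⟨Xu, hXu⟩ : ∃ F : Finset (Finset α), F = G.powerset.filter fun S => insert u S ∈ 𝒳 := ⟨_, rfl⟩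
  obtain ⟨Xv, hXv⟩ : ∃ F : Finset (Finset α), F = G.powerset.filter fun S => insert v S ∈ 𝒳 := ⟨_, rfl⟩
  obtain ⟨Z0, hZ0⟩ : ∃ F : Finset (Finset α), F = G.powerset.filter fun S => S ∈ 𝒵 := ⟨_, rfl⟩
  obtain ⟨Zu, hZu⟩ : ∃ F : Finset (Finset α), F = G.powerset.filter fun S => insert u S ∈ 𝒵 := ⟨_, rfl⟩
  obtain ⟨Zv, hZv⟩ : ∃ F : Finset (Finset α), F = G.powerset.filter fun S => insert v S ∈ 𝒵 := ⟨_, rfl⟩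
  have he𝒴 : ({u, v} : Finset α) ∈ 𝒳 ∩ 𝒵 := mem_inter.2 ⟨he𝒳, he𝒵⟩
  have h𝒴 : IsUpperSet ((𝒳 ∩ 𝒵 : Finset (Finset α)) : Set (Finset α)) := by
    rw [coe_inter]; exact h𝒳.inter h𝒵
  -- support and up-closure of the sections inside G
  have sub_of : ∀ {p : Finset α → Prop} [DecidablePred p], ∀ T ∈ G.powerset.filter p, T ⊆ G :=
    fun T hT => mem_powerset.1 (mem_filter.1 hT).1
  have hX0G : ∀ T ∈ X0, T ⊆ G := by rw [hX0]; exact sub_of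
  have hXuG : ∀ T ∈ Xu, T ⊆ G := by rw [hXu]; exact sub_of
  have hXvG : ∀ T ∈ Xv, T ⊆ G := by rw [hXv]; exact sub_of
  have hZ0G : ∀ T ∈ Z0, T ⊆ G := by rw [hZ0]; exact sub_of
  have hZuG : ∀ T ∈ Zu, T ⊆ G := by rw [hZu]; exact sub_of
  have hZvG : ∀ T ∈ Zv, T ⊆ G := by rw [hZv]; exact sub_of
  have up0 : ∀ {𝒲 : Finset (Finset α)}, IsUpperSet (𝒲 : Set (Finset α)) →
      ∀ A ∈ G.powerset.filter (fun S => S ∈ 𝒲), ∀ B : Finset α, A ⊆ B → B ⊆ G → B ∈ G.powerset.filter (fun S => S ∈ 𝒲) := by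
    intro 𝒲 h𝒲 A hA B hAB hBG
    exact mem_filter.2 ⟨mem_powerset.2 hBG, h𝒲 hAB (mem_filter.1 hA).2⟩
  have upw : ∀ {𝒲 : Finset (Finset α)} (w : α), IsUpperSet (𝒲 : Set (Finset α)) →
      ∀ A ∈ G.powerset.filter (fun S => insert w S ∈ 𝒲), ∀ B : Finset α, A ⊆ B → B ⊆ G →
        B ∈ G.powerset.filter (fun S => insert w S ∈ 𝒲) := by
    intro 𝒲 w h𝒲 A hA B hAB hBG
    exact mem_filter.2 ⟨mem_powerset.2 hBG, h𝒲 (insert_subset_insert w hAB) (mem_filter.1 hA).2⟩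
  have hX0Xu : X0 ⊆ Xu := by
    rw [hX0, hXu]; intro S hS
    exact mem_filter.2 ⟨(mem_filter.1 hS).1, h𝒳 (subset_insert u S) (mem_filter.1 hS).2⟩
  have hX0Xv : X0 ⊆ Xv := by
    rw [hX0, hXv]; intro S hS
    exact mem_filter.2 ⟨(mem_filter.1 hS).1, h𝒳 (subset_insert v S) (mem_filter.1 hS).2⟩
  have hZ0Zu : Z0 ⊆ Zu := by
    rw [hZ0, hZu]; intro S hS
    exact mem_filter.2 ⟨(mem_filter.1 hS).1, h𝒵 (subset_insert u S) (mem_filter.1 hS).2⟩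
  have hZ0Zv : Z0 ⊆ Zv := by
    rw [hZ0, hZv]; intro S hS
    exact mem_filter.2 ⟨(mem_filter.1 hS).1, h𝒵 (subset_insert v S) (mem_filter.1 hS).2⟩
  -- the empty set lies in neither section (all-live)
  have hu𝒳 : ({u} : Finset α) ∉ 𝒳 := fun h => by have h2 := hl𝒳 _ h; rw [card_singleton] at h2; omega
  have hu𝒵 : ({u} : Finset α) ∉ 𝒵 := fun h => by have h2 := hl𝒵 _ h; rw [card_singleton] at h2; omega
  have hv𝒳 : ({v} : Finset α) ∉ 𝒳 := fun h => by have h2 := hl𝒳 _ h; rw [card_singleton] at h2; omega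
  have he𝒳' : (∅ : Finset α) ∉ 𝒳 := fun h => by have h2 := hl𝒳 _ h; rw [card_empty] at h2; omega
  have hemp0 : (∅ : Finset α) ∈ G.powerset \ (X0 ∪ Z0) := by
    rw [mem_sdiff, mem_union, hX0, hZ0]
    refine ⟨mem_powerset.2 (empty_subset _), ?_⟩
    rintro (h | h)
    · exact he𝒳' (mem_filter.1 h).2
    · have h2 := hl𝒵 _ (mem_filter.1 h).2; rw [card_empty] at h2; omega
  have hempu : (∅ : Finset α) ∈ G.powerset \ (Xu ∪ Zu) := by
    rw [mem_sdiff, mem_union, hXu, hZu]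
    refine ⟨mem_powerset.2 (empty_subset _), ?_⟩
    rintro (h | h)
    · exact hu𝒳 (by simpa using (mem_filter.1 h).2)
    · exact hu𝒵 (by simpa using (mem_filter.1 h).2)
  have hempv : (∅ : Finset α) ∈ G.powerset \ (Xv ∪ Zv) := by
    rw [mem_sdiff, mem_union, hXv, hZv]
    refine ⟨mem_powerset.2 (empty_subset _), ?_⟩
    rintro (h | h)
    · exact hv𝒳 (by simpa using (mem_filter.1 h).2)
    · have h2 := hl𝒵 _ (by simpa using (mem_filter.1 h).2); rw [card_singleton] at h2; omega
  -- generating functions of the derived families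
  have gN0 : gf ((G.powerset \ (X0 ∪ Z0)).erase ∅) = gf G.powerset - gf X0 - gf Z0 + gf (X0 ∩ Z0) - 1 := by
    rw [gf_erase_empty hemp0, gf_sdiff_eq (union_subset (fun T hT => mem_powerset.2 (hX0G T hT))
      (fun T hT => mem_powerset.2 (hZ0G T hT)))]
    have h' : gf (X0 ∪ Z0) = gf X0 + gf Z0 - gf (X0 ∩ Z0) := by rw [← gf_union_add_gf_inter X0 Z0]; ring
    rw [h']; ring
  have gNu : gf ((G.powerset \ (Xu ∪ Zu)).erase ∅) = gf G.powerset - gf Xu - gf Zu + gf (Xu ∩ Zu) - 1 := by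
    rw [gf_erase_empty hempu, gf_sdiff_eq (union_subset (fun T hT => mem_powerset.2 (hXuG T hT))
      (fun T hT => mem_powerset.2 (hZuG T hT)))]
    have h' : gf (Xu ∪ Zu) = gf Xu + gf Zu - gf (Xu ∩ Zu) := by rw [← gf_union_add_gf_inter Xu Zu]; ring
    rw [h']; ring
  have gNv : gf ((G.powerset \ (Xv ∪ Zv)).erase ∅) = gf G.powerset - gf Xv - gf Zv + gf (Xv ∩ Zv) - 1 := by
    rw [gf_erase_empty hempv, gf_sdiff_eq (union_subset (fun T hT => mem_powerset.2 (hXvG T hT))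
      (fun T hT => mem_powerset.2 (hZvG T hT)))]
    have h' : gf (Xv ∪ Zv) = gf Xv + gf Zv - gf (Xv ∩ Zv) := by rw [← gf_union_add_gf_inter Xv Zv]; ring
    rw [h']; ring
  -- sections of 𝒳, 𝒵, 𝒴 = 𝒳 ∩ 𝒵
  have sX := gf_sections 𝒳 huv
  have sZ := gf_sections 𝒵 huv
  have sY := gf_sections (𝒳 ∩ 𝒵) huv
  rw [← hG] at sX sZ sY
  rw [sections_pair_eq h𝒳 he𝒳 G, ← hX0, ← hXu, ← hXv] at sX
  rw [sections_pair_eq h𝒵 he𝒵 G, ← hZ0, ← hZu, ← hZv] at sZ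
  rw [sections_pair_eq h𝒴 he𝒴 G, filter_mem_inter_eq 𝒳 𝒵 G (fun S => S), filter_mem_inter_eq 𝒳 𝒵 G (fun S => insert v S),
    filter_mem_inter_eq 𝒳 𝒵 G (fun S => insert u S), ← hX0, ← hXu, ← hXv, ← hZ0, ← hZu, ← hZv] at sY
  have sP := PiP_sections (α := α) huv
  rw [← hG] at sP
  -- the decomposition into manifestly nonnegative pieces
  have key : PiP * gf (𝒳 ∩ 𝒵) - gf 𝒳 * gf 𝒵 - X u * X v * (1 + X u + X v) * gf G.powerset =
      (gf G.powerset * gf (X0 ∩ Z0) - gf X0 * gf Z0)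
      + X u * ((gf G.powerset * gf (X0 ∩ Z0) - gf X0 * gf Z0) + (gf G.powerset * gf (Xu ∩ Zu) - gf Xu * gf Zu)
          + gf (Xu \ X0) * gf (Zu \ Z0))
      + X v * ((gf G.powerset * gf (X0 ∩ Z0) - gf X0 * gf Z0) + (gf G.powerset * gf (Xv ∩ Zv) - gf Xv * gf Zv)
          + gf (Xv \ X0) * gf (Zv \ Z0))
      + X u * X u * (gf G.powerset * gf (Xu ∩ Zu) - gf Xu * gf Zu)
      + X v * X v * (gf G.powerset * gf (Xv ∩ Zv) - gf Xv * gf Zv)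
      + X u * X v * ((gf G.powerset * gf (Xu ∩ Zv) - gf Xu * gf Zv) + (gf G.powerset * gf (Xv ∩ Zu) - gf Xv * gf Zu)
          + gf G.powerset * (gf ((G.powerset \ (X0 ∪ Z0)).erase ∅) + gf (Xu ∩ Zu) + gf (Xv ∩ Zv)
              - gf (Xu ∩ Zv) - gf (Xv ∩ Zu)))
      + X u * X u * X v * (gf G.powerset * gf ((G.powerset \ (Xu ∪ Zu)).erase ∅))
      + X u * X v * X v * (gf G.powerset * gf ((G.powerset \ (Xv ∪ Zv)).erase ∅)) := by
    rw [sX, sZ, sY, sP, gN0, gNu, gNv, gf_sdiff_eq hX0Xu, gf_sdiff_eq hZ0Zu, gf_sdiff_eq hX0Xv, gf_sdiff_eq hZ0Zv]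
    ring
  rw [hG] at key
  rw [key, ← hG]
  -- nonnegativity of the pieces
  have nP : ∀ m, 0 ≤ (gf G.powerset).coeff m := coeff_gf_nonneg _
  have h00 : ∀ m, 0 ≤ (gf G.powerset * gf (X0 ∩ Z0) - gf X0 * gf Z0).coeff m := by
    intro m; rw [hX0, hZ0]; exact coeff_harris_upIn_sub_nonneg sub_of sub_of (up0 h𝒳) (up0 h𝒵) m
  have huu : ∀ m, 0 ≤ (gf G.powerset * gf (Xu ∩ Zu) - gf Xu * gf Zu).coeff m := by
    intro m; rw [hXu, hZu]; exact coeff_harris_upIn_sub_nonneg sub_of sub_of (upw u h𝒳) (upw u h𝒵) m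
  have hvv : ∀ m, 0 ≤ (gf G.powerset * gf (Xv ∩ Zv) - gf Xv * gf Zv).coeff m := by
    intro m; rw [hXv, hZv]; exact coeff_harris_upIn_sub_nonneg sub_of sub_of (upw v h𝒳) (upw v h𝒵) m
  have huv' : ∀ m, 0 ≤ (gf G.powerset * gf (Xu ∩ Zv) - gf Xu * gf Zv).coeff m := by
    intro m; rw [hXu, hZv]; exact coeff_harris_upIn_sub_nonneg sub_of sub_of (upw u h𝒳) (upw v h𝒵) m
  have hvu' : ∀ m, 0 ≤ (gf G.powerset * gf (Xv ∩ Zu) - gf Xv * gf Zu).coeff m := by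
    intro m; rw [hXv, hZu]; exact coeff_harris_upIn_sub_nonneg sub_of sub_of (upw v h𝒳) (upw u h𝒵) m
  have hD : ∀ m, 0 ≤ (gf ((G.powerset \ (X0 ∪ Z0)).erase ∅) + gf (Xu ∩ Zu) + gf (Xv ∩ Zv)
      - gf (Xu ∩ Zv) - gf (Xv ∩ Zu)).coeff m := by
    intro m; rw [hX0, hZ0, hXu, hXv, hZu, hZv]; exact coeff_crossDefect_nonneg h𝒳 h𝒵 hl𝒳 G m
  have nXu : ∀ m, 0 ≤ (X u : MvPolynomial α ℤ).coeff m := coeff_X_nonneg' u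
  have nXv : ∀ m, 0 ≤ (X v : MvPolynomial α ℤ).coeff m := coeff_X_nonneg' v
  have nadd : ∀ {P Q : MvPolynomial α ℤ}, (∀ m, 0 ≤ P.coeff m) → (∀ m, 0 ≤ Q.coeff m) → ∀ m, 0 ≤ (P + Q).coeff m :=
    fun hP hQ m => by rw [coeff_add]; exact add_nonneg (hP m) (hQ m)
  refine nadd (nadd (nadd (nadd (nadd (nadd (nadd h00 ?_) ?_) ?_) ?_) ?_) ?_) ?_ n
  · exact coeff_mul_nonneg nXu (nadd (nadd h00 huu) (coeff_mul_nonneg (coeff_gf_nonneg _) (coeff_gf_nonneg _)))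
  · exact coeff_mul_nonneg nXv (nadd (nadd h00 hvv) (coeff_mul_nonneg (coeff_gf_nonneg _) (coeff_gf_nonneg _)))
  · exact coeff_mul_nonneg (coeff_mul_nonneg nXu nXu) huu
  · exact coeff_mul_nonneg (coeff_mul_nonneg nXv nXv) hvv
  · exact coeff_mul_nonneg (coeff_mul_nonneg nXu nXv) (nadd (nadd huv' hvu') (coeff_mul_nonneg nP hD))
  · exact coeff_mul_nonneg (coeff_mul_nonneg (coeff_mul_nonneg nXu nXu) nXv) (coeff_mul_nonneg nP (coeff_gf_nonneg _))
  · exact coeff_mul_nonneg (coeff_mul_nonneg (coeff_mul_nonneg nXu nXv) nXv) (coeff_mul_nonneg nP (coeff_gf_nonneg _))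

/-! ### Reduction of the single-common-edge case of CTC at co-level 2 to the scalar certificate -/

omit [Fintype α] in
/-- `GF({{u,v}}) = s_u·s_v` for `u ≠ v`. [this work] -/
theorem gf_pair_eq {u v : α} (huv : u ≠ v) : gf ({{u, v}} : Finset (Finset α)) = (X u * X v : MvPolynomial α ℤ) := by
  unfold gf
  rw [sum_singleton, show ({u, v} : Finset α) = insert u {v} from rfl, monomial_ind_insert (by simpa using huv)]
  congr 1
  rw [X_eq_gf_singleton v]; unfold gf; rw [sum_singleton]

/-- **Single common edge ⇒ CTC at co-level 2, modulo the scalar certificate** (memo g24 §2b–2c).  For all-live up-sets `𝒳, 𝒵` whose only common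
2-set is `{u,v}`, the all-live co-level-2 master polynomial `M₂ = e₂(Π+Θ₁)·(Π·Y − X·Z) − Π·Θ₁·e_{≥2}·GF(W₂)` satisfies
`M₂ = e₂(Π+Θ₁)·(H − s_us_v(1+s_u+s_v)Π_G) + s_us_v·(Π_G·F)` with `F = e₂(Π+Θ₁)(1+s_u+s_v) − Θ₁(Π−Θ₁)(1+s_u)(1+s_v)`, so it has nonnegative
coefficients as soon as `Π_G·F` has (the certificate of memo §2b, proved there on paper for every finite type; hypothesis `hF` here). [this work] -/
theorem coeff_M2_singleEdge_nonneg_of_cert {𝒳 𝒵 : Finset (Finset α)} (h𝒳 : IsUpperSet (𝒳 : Set (Finset α)))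
    (h𝒵 : IsUpperSet (𝒵 : Set (Finset α))) (hl𝒳 : ∀ S ∈ 𝒳, 2 ≤ #S) (hl𝒵 : ∀ S ∈ 𝒵, 2 ≤ #S) {u v : α} (huv : u ≠ v)
    (he𝒳 : {u, v} ∈ 𝒳) (he𝒵 : {u, v} ∈ 𝒵) (hW : ((𝒳 ∩ 𝒵).filter fun S => #S = 2) = {{u, v}})
    (hF : ∀ m, 0 ≤ (gf ((univ.erase u).erase v).powerset *
      (ee 2 * (PiP + Th1) * (1 + X u + X v) - Th1 * (PiP - Th1) * (1 + X u) * (1 + X v))).coeff m)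
    (n : α →₀ ℕ) :
    0 ≤ (ee 2 * (PiP + Th1) * (PiP * gf (𝒳 ∩ 𝒵) - gf 𝒳 * gf 𝒵)
      - PiP * Th1 * (PiP - Th1) * gf ((𝒳 ∩ 𝒵).filter fun S => #S = 2)).coeff n := by
  have sP := PiP_sections (α := α) huv
  have key : ee 2 * (PiP + Th1) * (PiP * gf (𝒳 ∩ 𝒵) - gf 𝒳 * gf 𝒵)
      - PiP * Th1 * (PiP - Th1) * gf ((𝒳 ∩ 𝒵).filter fun S => #S = 2) =
      ee 2 * (PiP + Th1) * (PiP * gf (𝒳 ∩ 𝒵) - gf 𝒳 * gf 𝒵 - X u * X v * (1 + X u + X v) * gf ((univ.erase u).erase v).powerset)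
      + X u * X v * (gf ((univ.erase u).erase v).powerset *
          (ee 2 * (PiP + Th1) * (1 + X u + X v) - Th1 * (PiP - Th1) * (1 + X u) * (1 + X v))) := by
    rw [hW, gf_pair_eq huv]
    -- only the product structure `Π = Π_G (1+s_u)(1+s_v)` is used
    set P := gf ((univ.erase u).erase v).powerset
    rw [sP]; ring
  rw [key, coeff_add]
  refine add_nonneg ?_ ?_
  · refine coeff_mul_nonneg (fun m => ?_) (coeff_harris_sub_edge_nonneg h𝒳 h𝒵 hl𝒳 hl𝒵 huv he𝒳 he𝒵) n
    unfold ee PiP Th1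
    exact coeff_mul_nonneg (coeff_gf_nonneg _) (fun m' => by rw [coeff_add]; exact add_nonneg (coeff_gf_nonneg _ m') (coeff_gf_nonneg _ m')) m
  · exact coeff_mul_nonneg (coeff_mul_nonneg (coeff_X_nonneg' u) (coeff_X_nonneg' v)) hF n

end Summit.CriticalPhenomena.PercolationContinuityZ3.Theorems.SahiCTCForms
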